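import Summits.QuantumFields.BalabanUV.Beta.D1BFx.ScaleLegBubbles
import Summits.QuantumFields.BalabanUV.Beta.D1BFx.CrossERecut
import Summits.QuantumFields.BalabanUV.Beta.D1BFx.FrozenLegTails

/-!
# `BalabanUV.Beta.D1BFx.CrossERecutTails` — road «BF-x» for binder row D1, «A3.c ∕ L-X TAILS» part (E): THE L-X ROW RE-CUT (β′) — the (REST′)
# line of the E-sector cross word `crossE′ = remK₃` bounded UNIFORMLY IN THE BLOCK SIZE from the END's rows d0∕d1 of `gfrz` (theorems modulo
# the PRINTED `h12`∕`h126`), h0∕h1 (theorems), the free anchor (theorem) and `hlam` — NO `DG 3 2`, NO shell row `h2s`∕`d2s`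

HONEST DEPENDENCY (page 1, mandatory): continuum YM on T⁴ ⇐ BetaPertH ∧ nine spine estimates (0/9 proved); BetaPertH ⇐ (D1) ∧ (D4) ∧
CAP+tail; G-an2-4 gates asym, D1 and NE2/3/4.  HONEST FRAMING (cell contract, verbatim): «discharging `BetaPertH` makes Bałaban's UV
stability UNCONDITIONAL — a real constructive-QFT result; it is NOT the continuum limit and NOT the Clay problem.»  THIS MODULE DISCHARGES
NOTHING of the wall: [folklore] composition BY NAME of part (D) `ScaleLegBubbles.exists_bound_fullSum_moment_bub` at the three re-cut cross words
(`CrossERecut.remW₃`: `bub vec₀μ rem₀ν`, `bub rem₀μ vec₀ν`, `bub rem₀μ rem₀ν`, gradings 1+2, 2+1, 2+2 from `CrossERestLists.graded_vec₀∕graded_rem₀`)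
with `CrossERecut.restK'_crossE_eq_remK₃`∕`weight_eq_of_hlam`, `FrozenLegTails.far_rows_d0_d1_of_prop12` (d0∕d1, modulo the PRINTED statements
`B5.Prop12Printed`∕`B5.Kernel126_127Printed` taken BY NAME as hypotheses `h12`∕`h126`: the gate records `conditional-result`) and the UNCONDITIONAL
`FrozenLegProfile.abs_gfrz_sub_gFree_le`∕`abs_gfrz_diff_flat_le` (h0∕h1).  No `def`, no `Prop` minted, nothing cited anew, 0 sorry.  0 wall binders
(root-level hW ∕ hR-sockets ∕ hSX-socket ∕ D1Tel ∕ D1Rep — 0); (K) NOT closed; NOT D1, NOT `BetaPertH`, NOT continuum, NOT Clay.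

ABSOLUTE RULE (cell charter, verbatim): «No internally-minted statement may enter as a cited fact. Every hypothesis is either kernel-proved in
this package or a verbatim quotation of a PUBLISHED theorem with page reference. The manuscript(s) under audit are NOT citable for their own
disputed steps — they are the thing under adjudication; programme-internal (2001/route/tribunal) claims are never citable.»

WHY (owner d1-p2-g9 RULINGS ρ-g9-31 «(β): L-X re-cut to the END's currency, no d3 letter» and ρ-g9-32 «GO (β′) … L-X will consume ONLY d0∕d1 of
`gfrz`, h0∕h1, the free anchor and `hlam` — NOT `h2s`∕`d2s`, NOT `DG 3 2`»; this lineage's located note N-d1leaf03g12-1, journal l.29701; K-LOCAL-ROWS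
v0.3).  This lineage's `CrossERecut.hRest_crossE'_packaged` (gen 4) bounded the cross word from a leg FAMILY with an3's uniform budget `DG 3 2` — a
third-difference row of `gfrz` that neither the END nor B5 Prop. 1.2 displays (leaf-03-g11 recon, l.29466).  Here the SAME (REST′) line is derived
from the rows the END already displays.
* §1 [folklore] `exists_bound_fullSum_remW₃` — the three words through an arbitrary profile under the four rows (part (D) three times, `fullSum_add`).
* §2 [folklore] **`hR_remK₃_of_rows`** — `∃ A ≥ 0, ∀ n ≥ 2, ∀ b ∈ image resSite, |fullSum (remK₃ n (gp n b) (cE n) (ω_gl n) μ ν)| ≤ |ω_gl n·(cE n·cE n)|·n⁻⁸·A`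
  for any base-point-indexed profile `gp` obeying the rows in the END's literal binder shape; `hRest_crossE'_of_rows` (+ `hlam` ⇒ `≤ 2N²·A`).
* §3 [folklore] **`hLoc_crossE'_of_prop12 (ha) (h12) (h126) (hlam)`** — THE `hLoc` CLAUSE of `RoadEndBFxRows.hGrp_of_rows` at
  `τ = inr (inr (inr (inr 1)))` for `gfrz`: `∃ C ≥ 0, ∀ n ≥ 2, |Σ_{b ∈ image resSite} n⁻⁴·fullSum (w ↦ restK' n a (gfrz n a b) … τ w)| ≤ C`.
  DEPENDENCE (owner ρ-g9-32 (ii)): `C = 2N²·A` with `A = A(a, δ, A₀, A₁, D₀, D₁; μ, ν)`, where `(δ, A₀, A₁)` are the constants of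
  `FrozenLegTails.far_rows_d0_d1_of_prop12 ha h12 h126` (functions of `a` and the two printed statements) and `D₀ = woodburyDc 0 + ellD0 4 a`,
  `D₁ = woodburyD1c 0 + ellD1 4 a`; `A` is assembled in parts (C1)∕(C2)∕(D) from these, the stencil lists `vec₀`∕`rem₀` and the free anchor's
  `IsO` constants — NO dependence on `n`, `b`, `N` (beyond the displayed prefactor `2N²` of `hlam`), and NO scalar letter beyond `hlam`.
Unit `b2b-balaban-beta-d1-formalise-leaf-03` (gen 12), D1 formalisation swarm; `LEAVES-BFx.md` row «A3.c ∕ L-X TAILS» part (E) (K-LOCAL-ROWS L-X).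
-/

noncomputable section

namespace Summit.QuantumFields.BalabanUV.Beta.D1BFx.CrossERecutTails

open Finset Filter Topology
open scoped BigOperators
open Literature.MathematicalPhysics.QuantumFieldTheory.Balaban1983to89
open Literature.MathematicalPhysics.QuantumFieldTheory.Balaban1983to89.Beta
open DyadicShell (Pt toReal supNorm)
open BubbleTransfer (unitVec)
open GhostTable (gFree)
open WindowIdentification (psum fullSum fullSum_add fullSum_const_mul)
open DressedMomentNormalisation (resSite)
open GradedBubbles (Fam bub Graded)
open LongitudinalWindow (ellD0 ellD1)
open WoodburyCovariant (woodburyDc woodburyD1c)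
open Summit.QuantumFields.BalabanUV.Beta.D1BFx.CrossERestLists (vec₀ rem₀ graded_vec₀ graded_rem₀)
open Summit.QuantumFields.BalabanUV.Beta.D1BFx.CrossERecut (remW₃ remK₃ restK'_crossE_eq_remK₃ weight_eq_of_hlam)
open Summit.QuantumFields.BalabanUV.Beta.D1BFx.Assembly (sum_uniform_resSite uniform_resSite_nonneg)
open Summit.QuantumFields.BalabanUV.Beta.D1BFx.ContactCount (abs_sum_mul_le_of_convex)
open Summit.QuantumFields.BalabanUV.Beta.D1BFx.ReducedKernel (TableR)
open Summit.QuantumFields.BalabanUV.Beta.D1BFx.SplitRecut (restK')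
open Summit.QuantumFields.BalabanUV.Beta.D1BFx.FrozenLegProfile (gfrz abs_gfrz_sub_gFree_le abs_gfrz_diff_flat_le)
open Summit.QuantumFields.BalabanUV.Beta.D1BFx.FrozenLegTails (nOf MOf hn1 far_rows_d0_d1_of_prop12)
open Summit.QuantumFields.BalabanUV.Beta.D1BFx.ScaleLegBubbles (exists_bound_fullSum_moment_bub)
open VectorTailsLoc (fam kfam)

/-! ## §1 The three re-cut cross words through an arbitrary profile under the four rows -/

section Words

variable {δ A₀ A₁ D₀ D₁ : ℝ} (μ ν : Fin 4)

/-- [folklore] **THE THREE WORDS OF `remW₃`, TWO-REGIME FORM**: ONE `A ≥ 0` with, for every scale `n ≥ 1` and every profile `g` obeying the four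
rows at scale `n`, convergence of the punctured partial sums and `|fullSum (w ↦ w_μw_ν·remW₃ g μ ν (−w))| ≤ A` (part (D) at the gradings
(1,2), (2,1), (2,2) of `CrossERestLists.graded_vec₀`∕`graded_rem₀`). -/
theorem exists_bound_fullSum_remW₃ (hδ : 0 < δ) (hA₀ : 0 ≤ A₀) (hA₁ : 0 ≤ A₁) (hD₀ : 0 ≤ D₀) (hD₁ : 0 ≤ D₁) :
    ∃ A : ℝ, 0 ≤ A ∧ ∀ (n : ℕ), 1 ≤ n → ∀ (g : Pt → ℝ),
      (∀ v : Pt, v ≠ 0 → |g v| ≤ A₀ * Real.exp (-(δ / n) * supNorm v) / (supNorm v : ℝ) ^ 2) →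
      (∀ v : Pt, v ≠ 0 → ∀ ρ : Fin 4, |g (v + unitVec ρ) - g v| ≤ A₁ * Real.exp (-(δ / n) * supNorm v) / (supNorm v : ℝ) ^ 3) →
      (∀ v : Pt, |g v - gFree v| ≤ D₀ / (n : ℝ) ^ 2) →
      (∀ (v : Pt) (ρ : Fin 4), |(g (v + unitVec ρ) - gFree (v + unitVec ρ)) - (g v - gFree v)| ≤ D₁ / (n : ℝ) ^ 3) →
        (∃ B : ℝ, Tendsto (psum (fun w : Pt => toReal w μ * toReal w ν * remW₃ (fun _ _ => g) μ ν 0 0 (-w))) atTop (𝓝 B)) ∧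
        |fullSum (fun w : Pt => toReal w μ * toReal w ν * remW₃ (fun _ _ => g) μ ν 0 0 (-w))| ≤ A := by
  obtain ⟨B₁, hB₁, h₁⟩ := exists_bound_fullSum_moment_bub (graded_vec₀ μ) (graded_rem₀ ν) (by norm_num) hδ hA₀ hA₁ hD₀ hD₁
  obtain ⟨B₂, hB₂, h₂⟩ := exists_bound_fullSum_moment_bub (graded_rem₀ μ) (graded_vec₀ ν) (by norm_num) hδ hA₀ hA₁ hD₀ hD₁
  obtain ⟨B₃, hB₃, h₃⟩ := exists_bound_fullSum_moment_bub (graded_rem₀ μ) (graded_rem₀ ν) (by norm_num) hδ hA₀ hA₁ hD₀ hD₁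
  refine ⟨B₁ + B₂ + B₃, by positivity, fun n hn g d0 d1 h0 h1 => ?_⟩
  obtain ⟨c₁, b₁⟩ := h₁ n hn g d0 d1 h0 h1 μ ν
  obtain ⟨c₂, b₂⟩ := h₂ n hn g d0 d1 h0 h1 μ ν
  obtain ⟨c₃, b₃⟩ := h₃ n hn g d0 d1 h0 h1 μ ν
  have e : (fun w : Pt => toReal w μ * toReal w ν * remW₃ (fun _ _ => g) μ ν 0 0 (-w)) =
      fun w : Pt => (toReal w μ * toReal w ν * bub (fun _ _ => g) (fun _ _ => g) (vec₀ μ) (rem₀ ν) 0 0 (-w)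
        + toReal w μ * toReal w ν * bub (fun _ _ => g) (fun _ _ => g) (rem₀ μ) (vec₀ ν) 0 0 (-w))
        + toReal w μ * toReal w ν * bub (fun _ _ => g) (fun _ _ => g) (rem₀ μ) (rem₀ ν) 0 0 (-w) := by
    funext w
    simp only [remW₃, Pi.add_apply]
    ring
  rw [e]
  have c₁₂ : ∃ B : ℝ, Tendsto (psum (fun w : Pt => toReal w μ * toReal w ν * bub (fun _ _ => g) (fun _ _ => g) (vec₀ μ) (rem₀ ν) 0 0 (-w)
      + toReal w μ * toReal w ν * bub (fun _ _ => g) (fun _ _ => g) (rem₀ μ) (vec₀ ν) 0 0 (-w))) atTop (𝓝 B) := by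
    obtain ⟨L₁, hL₁⟩ := c₁
    obtain ⟨L₂, hL₂⟩ := c₂
    refine ⟨L₁ + L₂, ?_⟩
    have := hL₁.add hL₂
    refine this.congr' (Eventually.of_forall fun R => ?_)
    simp only [psum, Finset.sum_add_distrib]
  refine ⟨?_, ?_⟩
  · obtain ⟨L, hL⟩ := c₁₂
    obtain ⟨L₃, hL₃⟩ := c₃
    refine ⟨L + L₃, ?_⟩
    have := hL.add hL₃
    refine this.congr' (Eventually.of_forall fun R => ?_)
    simp only [psum, Finset.sum_add_distrib]
  · rw [fullSum_add c₁₂ c₃, fullSum_add c₁ c₂]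
    calc |fullSum (fun w : Pt => toReal w μ * toReal w ν * bub (fun _ _ => g) (fun _ _ => g) (vec₀ μ) (rem₀ ν) 0 0 (-w))
          + fullSum (fun w : Pt => toReal w μ * toReal w ν * bub (fun _ _ => g) (fun _ _ => g) (rem₀ μ) (vec₀ ν) 0 0 (-w))
          + fullSum (fun w : Pt => toReal w μ * toReal w ν * bub (fun _ _ => g) (fun _ _ => g) (rem₀ μ) (rem₀ ν) 0 0 (-w))|
        ≤ |fullSum (fun w : Pt => toReal w μ * toReal w ν * bub (fun _ _ => g) (fun _ _ => g) (vec₀ μ) (rem₀ ν) 0 0 (-w))|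
          + |fullSum (fun w : Pt => toReal w μ * toReal w ν * bub (fun _ _ => g) (fun _ _ => g) (rem₀ μ) (vec₀ ν) 0 0 (-w))|
          + |fullSum (fun w : Pt => toReal w μ * toReal w ν * bub (fun _ _ => g) (fun _ _ => g) (rem₀ μ) (rem₀ ν) 0 0 (-w))| :=
          (abs_add_le _ _).trans (add_le_add (abs_add_le _ _) le_rfl)
      _ ≤ B₁ + B₂ + B₃ := add_le_add (add_le_add b₁ b₂) b₃

end Words

/-! ## §2 The (REST′) line for the re-cut cross word from the rows, in the END's binder shape -/

section Rows

variable {gp : (n : ℕ) → [NeZero n] → Pt → Pt → ℝ} {cE ωgl : ℕ → ℝ} {μ ν : Fin 4} {δ A₀ A₁ D₀ D₁ : ℝ}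

/-- [folklore] **THE RE-CUT CROSS WORD FROM THE ROWS**: if a base-point-indexed profile `gp n b` (scales `n ≠ 0`) obeys the END's far rows d0∕d1 (`n ≥ 2`,
`b ∈ image resSite`, `v ≠ 0`) and near rows h0∕h1 with constants `(δ, A₀, A₁, D₀, D₁)`, then ONE `A ≥ 0` gives, for every `n ≥ 2` and every base point,
convergence and `|fullSum (remK₃ n (gp n b) (cE n) (ω_gl n) μ ν)| ≤ |ω_gl n·(cE n·cE n)|·n⁻⁸·A`. -/
theorem hR_remK₃_of_rows (hδ : 0 < δ) (hA₀ : 0 ≤ A₀) (hA₁ : 0 ≤ A₁) (hD₀ : 0 ≤ D₀) (hD₁ : 0 ≤ D₁)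
    (d0 : ∀ n : ℕ, 2 ≤ n → ∀ [NeZero n], ∀ b ∈ (univ : Finset (Fin 4 → Fin n)).image resSite, ∀ v : Pt, v ≠ 0 →
      |gp n b v| ≤ A₀ * Real.exp (-(δ / n) * supNorm v) / (supNorm v : ℝ) ^ 2)
    (d1 : ∀ n : ℕ, 2 ≤ n → ∀ [NeZero n], ∀ b ∈ (univ : Finset (Fin 4 → Fin n)).image resSite, ∀ v : Pt, v ≠ 0 → ∀ ρ : Fin 4,
      |gp n b (v + unitVec ρ) - gp n b v| ≤ A₁ * Real.exp (-(δ / n) * supNorm v) / (supNorm v : ℝ) ^ 3)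
    (h0 : ∀ n : ℕ, 2 ≤ n → ∀ [NeZero n], ∀ b ∈ (univ : Finset (Fin 4 → Fin n)).image resSite, ∀ v : Pt, |gp n b v - gFree v| ≤ D₀ / (n : ℝ) ^ 2)
    (h1 : ∀ n : ℕ, 2 ≤ n → ∀ [NeZero n], ∀ b ∈ (univ : Finset (Fin 4 → Fin n)).image resSite, ∀ (v : Pt) (ρ : Fin 4),
      |(gp n b (v + unitVec ρ) - gFree (v + unitVec ρ)) - (gp n b v - gFree v)| ≤ D₁ / (n : ℝ) ^ 3) :
    ∃ A : ℝ, 0 ≤ A ∧ ∀ n : ℕ, 2 ≤ n → ∀ [NeZero n], ∀ b ∈ (univ : Finset (Fin 4 → Fin n)).image resSite,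
      (∃ B : ℝ, Tendsto (psum (remK₃ n (gp n b) (cE n) (ωgl n) μ ν)) atTop (𝓝 B)) ∧
      |fullSum (remK₃ n (gp n b) (cE n) (ωgl n) μ ν)| ≤ |ωgl n * (cE n * cE n)| * ((n : ℝ) ^ 8)⁻¹ * A := by
  obtain ⟨A, hA, h⟩ := exists_bound_fullSum_remW₃ μ ν hδ hA₀ hA₁ hD₀ hD₁
  refine ⟨(1 / 2 : ℝ) * A, by positivity, fun n hn _ b hb => ?_⟩
  have hn1 : 1 ≤ n := le_trans one_le_two hn
  obtain ⟨⟨L, hL⟩, hb'⟩ := h n hn1 (gp n b) (d0 n hn b hb) (d1 n hn b hb) (h0 n hn b hb) (h1 n hn b hb)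
  set κ : ℝ := ωgl n * (cE n * cE n) * ((n : ℝ) ^ 8)⁻¹ * (-(1 / 2 : ℝ)) with hκ
  have e : remK₃ n (gp n b) (cE n) (ωgl n) μ ν = fun w : Pt => κ * (toReal w μ * toReal w ν * remW₃ (fun _ _ => gp n b) μ ν 0 0 (-w)) := by
    funext w; simp only [remK₃, hκ]; ring
  rw [e]
  refine ⟨⟨κ * L, ?_⟩, ?_⟩
  · have := hL.const_mul κ
    refine this.congr' (Eventually.of_forall fun R => ?_)
    simp only [psum, Finset.mul_sum]
  · rw [fullSum_const_mul κ ⟨L, hL⟩, abs_mul]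
    have hκabs : |κ| = |ωgl n * (cE n * cE n)| * ((n : ℝ) ^ 8)⁻¹ * (1 / 2 : ℝ) := by
      rw [hκ, abs_mul, abs_mul, abs_of_nonneg (by positivity : (0 : ℝ) ≤ ((n : ℝ) ^ 8)⁻¹), show |(-(1 / 2 : ℝ))| = 1 / 2 by norm_num]
    rw [hκabs]
    calc |ωgl n * (cE n * cE n)| * ((n : ℝ) ^ 8)⁻¹ * (1 / 2 : ℝ) * |fullSum (fun w : Pt => toReal w μ * toReal w ν * remW₃ (fun _ _ => gp n b) μ ν 0 0 (-w))|
        ≤ |ωgl n * (cE n * cE n)| * ((n : ℝ) ^ 8)⁻¹ * (1 / 2 : ℝ) * A := mul_le_mul_of_nonneg_left hb' (by positivity)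
      _ = |ωgl n * (cE n * cE n)| * ((n : ℝ) ^ 8)⁻¹ * ((1 / 2 : ℝ) * A) := by ring

variable {a : ℝ} {cΛ cR cK cQ cE₂ cJ4 cΛ₂ cR₂ cQ₂ x₀ ωgh : ℕ → ℝ} {WE WJ WΛ WR WQ : ℕ → TableR} {N : ℝ}

/-- [folklore] **THE (REST′) LINE OF THE RE-CUT CROSS WORD FROM THE ROWS** (`τ = inr (inr (inr (inr 1)))`, `lam n = n⁸`): rows d0∕d1∕h0∕h1 for the
profile family `gp` + the END's `hlam` ⇒ `∃ A ≥ 0, ∀ n ≥ 2, |Σ_{b ∈ image resSite} n⁻⁴·fullSum (w ↦ restK' n a (gp n b) … (n⁸) N μ ν b τ w)| ≤ 2N²·A`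
— this lineage's `CrossERecut.hRest_crossE'_packaged` with the `DG 3 2` family budget REPLACED by the displayed rows. -/
theorem hRest_crossE'_of_rows (hδ : 0 < δ) (hA₀ : 0 ≤ A₀) (hA₁ : 0 ≤ A₁) (hD₀ : 0 ≤ D₀) (hD₁ : 0 ≤ D₁)
    (d0 : ∀ n : ℕ, 2 ≤ n → ∀ [NeZero n], ∀ b ∈ (univ : Finset (Fin 4 → Fin n)).image resSite, ∀ v : Pt, v ≠ 0 →
      |gp n b v| ≤ A₀ * Real.exp (-(δ / n) * supNorm v) / (supNorm v : ℝ) ^ 2)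
    (d1 : ∀ n : ℕ, 2 ≤ n → ∀ [NeZero n], ∀ b ∈ (univ : Finset (Fin 4 → Fin n)).image resSite, ∀ v : Pt, v ≠ 0 → ∀ ρ : Fin 4,
      |gp n b (v + unitVec ρ) - gp n b v| ≤ A₁ * Real.exp (-(δ / n) * supNorm v) / (supNorm v : ℝ) ^ 3)
    (h0 : ∀ n : ℕ, 2 ≤ n → ∀ [NeZero n], ∀ b ∈ (univ : Finset (Fin 4 → Fin n)).image resSite, ∀ v : Pt, |gp n b v - gFree v| ≤ D₀ / (n : ℝ) ^ 2)
    (h1 : ∀ n : ℕ, 2 ≤ n → ∀ [NeZero n], ∀ b ∈ (univ : Finset (Fin 4 → Fin n)).image resSite, ∀ (v : Pt) (ρ : Fin 4),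
      |(gp n b (v + unitVec ρ) - gFree (v + unitVec ρ)) - (gp n b v - gFree v)| ≤ D₁ / (n : ℝ) ^ 3)
    (hlam : ∀ n : ℕ, 2 ≤ n → ωgl n * cE n ^ 2 = 2 * N ^ 2 * (n : ℝ) ^ 8) :
    ∃ A : ℝ, 0 ≤ A ∧ ∀ n : ℕ, 2 ≤ n → ∀ [NeZero n],
      |∑ b ∈ (univ : Finset (Fin 4 → Fin n)).image resSite, ((n : ℝ) ^ 4)⁻¹ *
        fullSum (fun w : Pt => restK' n a (gp n b) (cE n) (cΛ n) (cR n) (cK n) (cQ n) (cE₂ n) (cJ4 n) (cΛ₂ n) (cR₂ n) (cQ₂ n) (x₀ n)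
          (WE n) (WJ n) (WΛ n) (WR n) (WQ n) (ωgl n) (ωgh n) ((n : ℝ) ^ 8) N μ ν b (Sum.inr (Sum.inr (Sum.inr (Sum.inr 1)))) w)| ≤
        2 * N ^ 2 * A := by
  obtain ⟨A, hA, h⟩ := hR_remK₃_of_rows (cE := cE) (ωgl := ωgl) (μ := μ) (ν := ν) hδ hA₀ hA₁ hD₀ hD₁ d0 d1 h0 h1
  refine ⟨A, hA, fun n hn _ => ?_⟩
  have e : ∀ b : Pt, (fun w : Pt => restK' n a (gp n b) (cE n) (cΛ n) (cR n) (cK n) (cQ n) (cE₂ n) (cJ4 n) (cΛ₂ n) (cR₂ n) (cQ₂ n) (x₀ n)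
      (WE n) (WJ n) (WΛ n) (WR n) (WQ n) (ωgl n) (ωgh n) ((n : ℝ) ^ 8) N μ ν b (Sum.inr (Sum.inr (Sum.inr (Sum.inr 1)))) w) =
        remK₃ n (gp n b) (cE n) (ωgl n) μ ν := fun b => restK'_crossE_eq_remK₃ n (gp n b) (cE n) (ωgl n) μ ν b _ _ _ _ _ _ _ _ _ _ _ _ _ _ _ _ _ _ _
  simp only [e]
  have hw : |ωgl n * (cE n * cE n)| * ((n : ℝ) ^ 8)⁻¹ = 2 * N ^ 2 := weight_eq_of_hlam (by omega) (hlam n hn)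
  refine abs_sum_mul_le_of_convex _ (fun b hb => uniform_resSite_nonneg n b hb) (sum_uniform_resSite (NeZero.ne n)) fun b hb => ?_
  rw [← hw]
  exact (h n hn b hb).2

end Rows

/-! ## §3 The `hLoc` clause of the END for the cross word, from the two printed statements and `hlam` -/

section End

variable {a : ℝ} {cE cΛ cR cK cQ cE₂ cJ4 cΛ₂ cR₂ cQ₂ x₀ ωgl ωgh : ℕ → ℝ} {WE WJ WΛ WR WQ : ℕ → TableR} {N : ℝ} {μ ν : Fin 4}

/-- [folklore] **THE `hLoc` CLAUSE OF `RoadEndBFxRows.hGrp_of_rows` AT `τ = inr (inr (inr (inr 1)))` (the re-cut E-sector cross word) FOR THE ROAD'S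
FROZEN PROFILE `gfrz`, MODULO [B5, Prop. 1.2 (1.110)–(1.114)] AND [B5, (1.126)–(1.127)] BY NAME (`h12`∕`h126`, exactly as the END displays them) AND
THE END's `hlam`**: `∃ C ≥ 0, ∀ n ≥ 2, |Σ_{b ∈ image resSite} n⁻⁴·fullSum (w ↦ restK' n a (gfrz n a b) … (n⁸) N μ ν b τ w)| ≤ C`.
DEPENDENCE (owner ρ-g9-32 (ii)): `C = 2N²·A(a, δ, A₀, A₁, D₀, D₁; μ, ν)` with `(δ, A₀, A₁)` from `FrozenLegTails.far_rows_d0_d1_of_prop12 ha h12 h126`,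
`D₀ = woodburyDc 0 + ellD0 4 a`, `D₁ = woodburyD1c 0 + ellD1 4 a`; no `n`, no `b`; NO scalar letter beyond `hlam`; NO `h2s`∕`d2s`; NO `DG 3 2`. -/
theorem hLoc_crossE'_of_prop12 (ha : 0 < a) (h12 : B5.Prop12Printed (fam nOf hn1 MOf a ha)) (h126 : B5.Kernel126_127Printed (kfam nOf MOf))
    (hlam : ∀ n : ℕ, 2 ≤ n → ωgl n * cE n ^ 2 = 2 * N ^ 2 * (n : ℝ) ^ 8) :
    ∃ C : ℝ, 0 ≤ C ∧ ∀ n : ℕ, 2 ≤ n → ∀ [NeZero n],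
      |∑ b ∈ (univ : Finset (Fin 4 → Fin n)).image resSite, ((n : ℝ) ^ 4)⁻¹ *
        fullSum (fun w : Pt => restK' n a (gfrz n a b) (cE n) (cΛ n) (cR n) (cK n) (cQ n) (cE₂ n) (cJ4 n) (cΛ₂ n) (cR₂ n) (cQ₂ n) (x₀ n)
          (WE n) (WJ n) (WΛ n) (WR n) (WQ n) (ωgl n) (ωgh n) ((n : ℝ) ^ 8) N μ ν b (Sum.inr (Sum.inr (Sum.inr (Sum.inr 1)))) w)| ≤ C := by
  obtain ⟨δ, A₀, A₁, hδ, hA₀, hA₁, d0, d1⟩ := far_rows_d0_d1_of_prop12 ha h12 h126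
  have hD₀ : 0 ≤ woodburyDc 0 + ellD0 4 a := add_nonneg VectorLegVolumeAdapter.woodburyDc_zero_nonneg (OffDiagonalLegGrade.ellD0_nonneg ha)
  have hD₁ : 0 ≤ woodburyD1c 0 + ellD1 4 a := add_nonneg VectorLegVolumeAdapter.woodburyD1c_zero_nonneg (OffDiagonalLegGrade.ellD1_nonneg ha)
  obtain ⟨A, hA, h⟩ := hRest_crossE'_of_rows (gp := fun n _ b v => gfrz n a b v) (a := a) (cE := cE) (cΛ := cΛ) (cR := cR) (cK := cK) (cQ := cQ)
    (cE₂ := cE₂) (cJ4 := cJ4) (cΛ₂ := cΛ₂) (cR₂ := cR₂) (cQ₂ := cQ₂) (x₀ := x₀) (ωgh := ωgh) (WE := WE) (WJ := WJ) (WΛ := WΛ) (WR := WR) (WQ := WQ)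
    (N := N) (μ := μ) (ν := ν) hδ hA₀ hA₁ hD₀ hD₁ d0 d1
    (fun n hn _ b _ v => abs_gfrz_sub_gFree_le n (le_trans one_le_two hn) ha b v)
    (fun n hn _ b _ v ρ => abs_gfrz_diff_flat_le n (le_trans one_le_two hn) ha b v ρ) hlam
  exact ⟨2 * N ^ 2 * A, by positivity, h⟩

end End

end Summit.QuantumFields.BalabanUV.Beta.D1BFx.CrossERecutTails

end
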